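import Literature.Geometry.Riemannian.CalabiMinimalGeodesicCutLocus
import Literature.Geometry.Riemannian.LipschitzSmoothing
import Literature.Geometry.Riemannian.DistSqDirectionalDatumAux
import HarnessLib

/-!
# The eikonal equation `|∇ d(q, ·)| = 1` off the cut locus

For the distance function `r = d(q, ·)` of a connected complete Riemannian manifold:
(i) every function `f` with `|f(y) - f(z)| ≤ d(y, z)` satisfies `|df_x(v)| ≤ |v|_g` and
`|∇f|²_g(x) ≤ 1` wherever it is differentiable (test along the geodesic `σ ↦ exp_x(σ v)`);
(ii) the radial derivative of `r` along a minimal geodesic from `q` is `1`; hence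
(iii) **`|∇r|² = 1` at every point `exp_q(w)`, `w ∈ ID(q) ∖ {0}`**, i.e. off `{q} ∪ Cut(q)`
(Petersen 2016, §5.7 / Lee 2018, Thm. 6.34 "the distance function satisfies `|grad r| = 1`";
Sakai 1996, Prop. III.4.8). We PROVE (i)–(iii), and (iv) the consequences `Δ(ζ ∘ r) = ζ'' + ζ' Δr` and
`Δ(ζ ∘ r) ≤ ζ'' + ζ'(m-1) coth r` (`ζ' ≥ 0`, `Ric ≥ -(m-1)`) at such points, and (v) `∇r = γ̇`
(the metric dual of `dr` is the radial unit vector, `sharp_mvfderiv_edist_eq_velocity`).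
No definitions, no named facts (D-0026).
Groundwork for `CheegerColding1997_sphereStability` (Laplacian of functions of the distance,
`Δ(φ ∘ r) = φ''|∇r|² + φ' Δr`, Hopf–Calabi bumps, Cheeger–Colding 1996 §1–§2).

## References

* J. M. Lee, *Introduction to Riemannian Manifolds* (2018), Thm. 6.34, Thm. 10.34. [LeeRiemannianManifolds2018]
* P. Petersen, *Riemannian Geometry*, 3rd ed. (2016), Lemma 5.7.8. [Petersen2016]
-/

noncomputable section

open Bundle Set Function Filter
open scoped Manifold ContDiff Topology ENNReal NNReal Real

namespace Literature.Geometry.Riemannian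

open Lorentzian Lorentzian.PseudoRiemannianMetric

variable {E : Type*} [NormedAddCommGroup E] [NormedSpace ℝ E] [FiniteDimensional ℝ E]
  [CompleteSpace E] {M : Type*} [TopologicalSpace M] [ChartedSpace E M] [IsManifold 𝓘(ℝ, E) ∞ M]
  [T2Space M]
  (g : PseudoRiemannianMetric 𝓘(ℝ, E) ∞ E (TangentSpace 𝓘(ℝ, E) : M → Type _)) [g.HasLeviCivita]
  [CovariantDerivative.ContMDiffCovariantDerivative g.leviCivita 1]
  [CovariantDerivative.ContMDiffCovariantDerivative g.leviCivita ∞]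

/-! ### (i) `1`-Lipschitz functions have `|df| ≤ 1` -/

/-- **The differential of a distance-nonincreasing function**: if `|f(y) - f(z)| ≤ d(y, z)` for
all `y, z` and `f` is differentiable at `x`, then `|df_x(v)| ≤ |v|_g` (test along
`σ ↦ exp_x(σ v)`, of length `|σ| |v|_g`). [folklore] -/
theorem abs_mvfderiv_le_sqrt_of_abs_sub_le_edist (hg : g.IsRiemannian)
    (hc : IsGeodesicallyComplete g.leviCivita) {f : M → ℝ}
    (hlip : ∀ y z : M, |f y - f z| ≤ (g.edist hg y z).toReal) {x : M}
    (hf : MDifferentiableAt 𝓘(ℝ, E) 𝓘(ℝ, ℝ) f x) (v : TangentSpace 𝓘(ℝ, E) x) :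
    |mvfderiv 𝓘(ℝ, E) f x v| ≤ Real.sqrt (g.val x v v) := by
  haveI : Fact ((1 : ℕ∞ω) ≤ (∞ : ℕ∞ω)) := ⟨by exact_mod_cast le_top⟩
  -- reduce to a unit vector
  by_cases hv : v = 0
  · rw [hv, map_zero, map_zero]; simp
  set a : ℝ := Real.sqrt (g.val x v v) with ha_def
  have hvv : 0 < g.val x v v := hg x v hv
  have ha : 0 < a := Real.sqrt_pos.2 hvv
  set u : TangentSpace 𝓘(ℝ, E) x := a⁻¹ • v with hu_def
  have hu : g.val x u u = 1 := by
    simp only [hu_def, map_smul, FunLike.coe_smul, Pi.smul_apply, smul_eq_mul]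
    rw [← mul_assoc, ← mul_inv, show a * a = g.val x v v by rw [ha_def, Real.mul_self_sqrt hvv.le],
      inv_mul_cancel₀ hvv.ne']
  -- the curve `σ ↦ exp_x(σ u)` and `f` along it
  set γ : ℝ → M := fun σ ↦ expMap g.leviCivita x (σ • u) with hγ
  have hγs : ContMDiff 𝓘(ℝ, ℝ) 𝓘(ℝ, E) ∞ γ := (contMDiff_and_unit_speed_expMap_smul g hc x u hu).1
  have hγ0 : γ 0 = x := by simp only [hγ, zero_smul]; exact expMap_zero (cov := g.leviCivita) x
  have hvel : velocity 𝓘(ℝ, E) γ 0 = u := velocity_expMap_smul_zero x u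
  have hderiv : HasDerivAt (fun σ ↦ f (γ σ)) (mvfderiv 𝓘(ℝ, E) f x u) 0 := by
    have hf' : MDifferentiableAt 𝓘(ℝ, E) 𝓘(ℝ, ℝ) f (γ 0) := by rw [hγ0]; exact hf
    have h := hasDerivAt_comp_curve_mvfderiv hf' ((hγs 0).mdifferentiableAt (by simp))
    rw [hvel] at h
    have heq : mvfderiv 𝓘(ℝ, E) f (γ 0) u = mvfderiv 𝓘(ℝ, E) f x u := by rw [hγ0]
    rwa [heq] at h
  -- `|f(γ σ) - f(x)| ≤ |σ|`
  have hbound : ∀ σ : ℝ, ‖f (γ σ) - f (γ 0)‖ ≤ 1 * ‖σ - 0‖ := fun σ ↦ by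
    rw [hγ0, one_mul, sub_zero, Real.norm_eq_abs, Real.norm_eq_abs]
    have h1 := hlip (γ σ) x
    have h2 := (edist_expMap_smul_toReal_le_abs g hg hc x u hu σ).2
    rw [g.edist_comm hg] at h2
    exact h1.trans h2
  have hle : ‖mvfderiv 𝓘(ℝ, E) f x u‖ ≤ 1 :=
    hderiv.le_of_lip' zero_le_one (Filter.Eventually.of_forall hbound)
  rw [Real.norm_eq_abs] at hle
  -- back to `v = a u`
  have hv' : v = a • u := by
    rw [hu_def, smul_smul, mul_inv_cancel₀ ha.ne', one_smul]
  rw [hv', map_smul, smul_eq_mul, abs_mul, abs_of_pos ha]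
  calc a * |mvfderiv 𝓘(ℝ, E) f x u| ≤ a * 1 := mul_le_mul_of_nonneg_left hle ha.le
    _ = a := mul_one a

/-- **`|∇f|² ≤ 1` for a distance-nonincreasing function** at a point of differentiability.
[folklore] -/
theorem gradSq_le_one_of_abs_sub_le_edist (hg : g.IsRiemannian)
    (hc : IsGeodesicallyComplete g.leviCivita) {f : M → ℝ}
    (hlip : ∀ y z : M, |f y - f z| ≤ (g.edist hg y z).toReal) {x : M}
    (hf : MDifferentiableAt 𝓘(ℝ, E) 𝓘(ℝ, ℝ) f x) : g.gradSq f x ≤ 1 := by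
  have h := gradSq_le_sq_of_forall_abs_mvfderiv_le g hg zero_le_one (χ := f) (x := x)
    (fun v ↦ by rw [one_mul]; exact abs_mvfderiv_le_sqrt_of_abs_sub_le_edist g hg hc hlip hf v)
  rwa [one_pow] at h

omit [CompleteSpace E] [T2Space M] [g.HasLeviCivita]
  [CovariantDerivative.ContMDiffCovariantDerivative g.leviCivita 1]
  [CovariantDerivative.ContMDiffCovariantDerivative g.leviCivita ∞] in
/-- **The distance function is distance-nonincreasing**: `|d(q,y) - d(q,z)| ≤ d(y, z)`.
[folklore] -/
theorem abs_edist_toReal_sub_le [ConnectedSpace M] (hg : g.IsRiemannian) (q y z : M) :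
    |(g.edist hg q y).toReal - (g.edist hg q z).toReal| ≤ (g.edist hg y z).toReal := by
  have htri : ∀ a b c : M, (g.edist hg a b).toReal ≤ (g.edist hg a c).toReal + (g.edist hg c b).toReal :=
    fun a b c ↦ by
    have h := ENNReal.toReal_mono (ENNReal.add_ne_top.2 ⟨edist_ne_top hg a c, edist_ne_top hg c b⟩)
      (g.edist_triangle hg a c b)
    rwa [ENNReal.toReal_add (edist_ne_top hg a c) (edist_ne_top hg c b)] at h
  have h1 := htri q y z
  have h2 := htri q z y
  rw [g.edist_comm hg z y] at h1
  rw [abs_le]; constructor <;> linarith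

/-- **`|∇ d(q,·)|² ≤ 1`** wherever the distance function is differentiable. [folklore] -/
theorem gradSq_edist_le_one [ConnectedSpace M] (hg : g.IsRiemannian)
    (hc : IsGeodesicallyComplete g.leviCivita) (q : M) {x : M}
    (hf : MDifferentiableAt 𝓘(ℝ, E) 𝓘(ℝ, ℝ) (fun z ↦ (g.edist hg q z).toReal) x) :
    g.gradSq (fun z ↦ (g.edist hg q z).toReal) x ≤ 1 :=
  gradSq_le_one_of_abs_sub_le_edist g hg hc (abs_edist_toReal_sub_le g hg q) hf

/-! ### (ii) The radial derivative of the distance function is `1` -/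

/-- **Radial derivative of the distance function**: along a unit-speed geodesic
`γ(σ) = exp_q(σ u)` minimizing on `[0, T]`, `T > 0`, if `d(q, ·)` is differentiable at `γ(T)`
then `d(d(q,·))_{γ(T)}(γ'(T)) = 1` (the left derivative of `σ ↦ d(q, γ σ) = σ` at `T`).
[cite: LeeRiemannianManifolds2018, Thm. 6.34] -/
theorem mvfderiv_edist_velocity_eq_one [ConnectedSpace M] (hg : g.IsRiemannian)
    (hc : IsGeodesicallyComplete g.leviCivita) (q : M) (u : TangentSpace 𝓘(ℝ, E) q)
    (hu : g.val q u u = 1) {T : ℝ} (hT : 0 < T) (hmin : IsMinimizingUpTo g hg q u T)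
    (hf : MDifferentiableAt 𝓘(ℝ, E) 𝓘(ℝ, ℝ) (fun z ↦ (g.edist hg q z).toReal)
      (expMap g.leviCivita q (T • u))) :
    mvfderiv 𝓘(ℝ, E) (fun z ↦ (g.edist hg q z).toReal) (expMap g.leviCivita q (T • u))
      (velocity 𝓘(ℝ, E) (fun σ ↦ expMap g.leviCivita q (σ • u)) T) = 1 := by
  haveI : Fact ((1 : ℕ∞ω) ≤ (∞ : ℕ∞ω)) := ⟨by exact_mod_cast le_top⟩
  set γ : ℝ → M := fun σ ↦ expMap g.leviCivita q (σ • u) with hγ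
  have hγs : ContMDiff 𝓘(ℝ, ℝ) 𝓘(ℝ, E) ∞ γ := (contMDiff_and_unit_speed_expMap_smul g hc q u hu).1
  set c : ℝ → ℝ := fun σ ↦ (g.edist hg q (γ σ)).toReal with hc_def
  -- `c(σ) = σ` on `[0, T]`
  have hcσ : ∀ σ ∈ Icc (0 : ℝ) T, c σ = σ := by
    intro σ hσ
    have h := edist_expMap_smul_expMap_smul g hg hc q u hu hmin le_rfl hσ.1 hσ.2
    rw [zero_smul, expMap_zero] at h
    show (g.edist hg q (expMap g.leviCivita q (σ • u))).toReal = σ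
    rw [h, sub_zero, ENNReal.toReal_ofReal hσ.1]
  -- the two-sided derivative exists (chain rule) and the left derivative is `1`
  have hD : HasDerivAt c (mvfderiv 𝓘(ℝ, E) (fun z ↦ (g.edist hg q z).toReal) (γ T)
      (velocity 𝓘(ℝ, E) γ T)) T :=
    hasDerivAt_comp_curve_mvfderiv hf ((hγs T).mdifferentiableAt (by simp))
  have h1 : HasDerivWithinAt c (mvfderiv 𝓘(ℝ, E) (fun z ↦ (g.edist hg q z).toReal) (γ T)
      (velocity 𝓘(ℝ, E) γ T)) (Iio T) T := hD.hasDerivWithinAt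
  have h2 : HasDerivWithinAt c 1 (Iio T) T := by
    refine (hasDerivWithinAt_id T (Iio T)).congr_of_eventuallyEq ?_ (hcσ T ⟨hT.le, le_rfl⟩)
    have : Ioo 0 T ∈ 𝓝[<] T := Ioo_mem_nhdsLT hT
    filter_upwards [this] with σ hσ
    exact hcσ σ ⟨hσ.1.le, hσ.2.le⟩
  exact (uniqueDiffWithinAt_Iio T).eq_deriv _ h1 h2

/-! ### (iii) The eikonal equation off the cut locus -/

/-- **`|∇ d(q, ·)|² = 1` at `exp_q(w)`, `w ∈ ID(q) ∖ {0}`** (Lee 2018, Thm. 6.34 with Thm. 10.34;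
Petersen 2016, Lemma 5.7.8): `≤ 1` because `d(q,·)` is distance-nonincreasing, `≥ 1` because its
derivative along the unit radial geodesic is `1`. [cite: LeeRiemannianManifolds2018, Thm. 6.34] -/
theorem gradSq_edist_eq_one_of_mem_injectivityDomain [ConnectedSpace M] (hg : g.IsRiemannian)
    (hc : IsGeodesicallyComplete g.leviCivita) (q : M) {w : TangentSpace 𝓘(ℝ, E) q}
    (hw : w ∈ injectivityDomain g hg q) (hw0 : w ≠ 0) :
    g.gradSq (fun z ↦ (g.edist hg q z).toReal) (expMap g.leviCivita q w) = 1 := by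
  haveI : Fact ((1 : ℕ∞ω) ≤ (∞ : ℕ∞ω)) := ⟨by exact_mod_cast le_top⟩
  have hsmooth := contMDiffAt_edist_toReal_of_mem_injectivityDomain g hg hc q hw hw0
  have hdiff : MDifferentiableAt 𝓘(ℝ, E) 𝓘(ℝ, ℝ) (fun z ↦ (g.edist hg q z).toReal)
      (expMap g.leviCivita q w) := hsmooth.mdifferentiableAt (by simp)
  refine le_antisymm (gradSq_edist_le_one g hg hc q hdiff) ?_
  -- write `w = T u` with `u` a unit vector, `T = |w|`
  have hww : 0 < g.val q w w := hg q w hw0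
  set T : ℝ := Real.sqrt (g.val q w w) with hT_def
  have hT : 0 < T := Real.sqrt_pos.2 hww
  set u : TangentSpace 𝓘(ℝ, E) q := T⁻¹ • w with hu_def
  have hu : g.val q u u = 1 := by
    simp only [hu_def, map_smul, FunLike.coe_smul, Pi.smul_apply, smul_eq_mul]
    rw [← mul_assoc, ← mul_inv, show T * T = g.val q w w by rw [hT_def, Real.mul_self_sqrt hww.le],
      inv_mul_cancel₀ hww.ne']
  have hwTu : w = T • u := by rw [hu_def, smul_smul, mul_inv_cancel₀ hT.ne', one_smul]
  -- `u` minimizes up to `T` (indeed beyond: `w ∈ ID(q)`)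
  have hmin : IsMinimizingUpTo g hg q u T := by
    obtain ⟨s, hs, hmin⟩ := hw
    rw [hwTu, isMinimizingUpTo_smul_iff hg hc q u hT] at hmin
    exact hmin.mono hc hT.le (by nlinarith)
  have hdiff' : MDifferentiableAt 𝓘(ℝ, E) 𝓘(ℝ, ℝ) (fun z ↦ (g.edist hg q z).toReal)
      (expMap g.leviCivita q (T • u)) := by rw [← hwTu]; exact hdiff
  have hrad := mvfderiv_edist_velocity_eq_one g hg hc q u hu hT hmin hdiff'
  -- Cauchy–Schwarz: `1 = dr(γ') ≤ |∇r| |γ'| = |∇r|`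
  have hspeed : g.val (expMap g.leviCivita q (T • u))
      (velocity 𝓘(ℝ, E) (fun σ ↦ expMap g.leviCivita q (σ • u)) T)
      (velocity 𝓘(ℝ, E) (fun σ ↦ expMap g.leviCivita q (σ • u)) T) = 1 := by
    rw [val_velocity_expMap_smul g hc q u T, hu]
  have hCS := abs_mvfderiv_le_sqrt_gradSq_mul_sqrt g hg (fun z ↦ (g.edist hg q z).toReal)
    (expMap g.leviCivita q (T • u)) (velocity 𝓘(ℝ, E) (fun σ ↦ expMap g.leviCivita q (σ • u)) T)
  rw [hrad, hspeed, Real.sqrt_one, mul_one, abs_one] at hCS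
  rw [hwTu]
  have hnn : 0 ≤ g.gradSq (fun z ↦ (g.edist hg q z).toReal) (expMap g.leviCivita q (T • u)) := by
    by_contra hneg
    rw [not_le] at hneg
    rw [Real.sqrt_eq_zero'.2 hneg.le] at hCS
    linarith
  calc (1 : ℝ) = 1 ^ 2 := by norm_num
    _ ≤ Real.sqrt (g.gradSq (fun z ↦ (g.edist hg q z).toReal) (expMap g.leviCivita q (T • u))) ^ 2 := by
        gcongr
    _ = _ := Real.sq_sqrt hnn

/-- **The eikonal equation off `{q} ∪ Cut(q)`**: for `z ∉ cutLocus q`, `z ≠ q`,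
`|∇ d(q, ·)|²(z) = 1`. [cite: LeeRiemannianManifolds2018, Thm. 6.34, Thm. 10.34] -/
theorem gradSq_edist_eq_one_of_not_mem_cutLocus [ConnectedSpace M] (hg : g.IsRiemannian)
    (hc : IsGeodesicallyComplete g.leviCivita) {q z : M} (hz : z ∉ cutLocus g hg q) (hzq : z ≠ q) :
    g.gradSq (fun z' ↦ (g.edist hg q z').toReal) z = 1 := by
  obtain ⟨-, -, himg, -, -⟩ := lee_expMap_injectivityDomain_holds le_rfl g hg hc q
  rw [cutLocus_eq_geodesicCutLocus le_rfl hg hc q] at hz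
  have hz' : z ∈ (geodesicCutLocus g hg q)ᶜ := hz
  rw [← himg] at hz'
  obtain ⟨w, hw, rfl⟩ := hz'
  have hw0 : w ≠ 0 := by
    rintro rfl
    exact hzq (expMap_zero (cov := g.leviCivita) q)
  exact gradSq_edist_eq_one_of_mem_injectivityDomain g hg hc q hw hw0

/-! ### (iv) The Laplacian of a function of the distance -/

/-- **`Δ(ζ ∘ r) = ζ''(r) + ζ'(r) Δr` off `{q} ∪ Cut(q)`** (`r = d(q, ·)`): the chain rule
`Δ(ζ ∘ u) = ζ''|∇u|² + ζ' Δu` (`dalembertian_real_comp`) with the eikonal equation `|∇r|² = 1`,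
at a point `z ∉ cutLocus q`, `z ≠ q`, for `ζ` of class `C²` at `r(z)`. Petersen 2016, §5.7 /
Cheeger–Colding 1996, §1 (Laplacians of radial functions `G ∘ r` of the comparison arguments).
[cite: LeeRiemannianManifolds2018, Thm. 6.34] [cite: CheegerColding1996, §1] -/
theorem laplaceBeltrami_real_comp_edist [ConnectedSpace M] (hg : g.IsRiemannian)
    (hc : IsGeodesicallyComplete g.leviCivita) {q z : M} (hz : z ∉ cutLocus g hg q) (hzq : z ≠ q)
    {ζ : ℝ → ℝ} (hζ : ContDiffAt ℝ 2 ζ (g.edist hg q z).toReal) :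
    g.laplaceBeltrami (ζ ∘ fun z' ↦ (g.edist hg q z').toReal) z =
      deriv (deriv ζ) (g.edist hg q z).toReal +
        deriv ζ (g.edist hg q z).toReal * g.laplaceBeltrami (fun z' ↦ (g.edist hg q z').toReal) z := by
  haveI : Fact ((1 : ℕ∞ω) ≤ (∞ : ℕ∞ω)) := ⟨by exact_mod_cast le_top⟩
  have hsm : ContMDiffAt 𝓘(ℝ, E) 𝓘(ℝ, ℝ) 2 (fun z' ↦ (g.edist hg q z').toReal) z :=
    (contMDiffAt_edist_toReal_of_not_mem_cutLocus g hg hc hz hzq).of_le (WithTop.coe_le_coe.2 le_top)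
  have heik := gradSq_edist_eq_one_of_not_mem_cutLocus g hg hc hz hzq
  rw [PseudoRiemannianMetric.gradSq] at heik
  rw [laplaceBeltrami_eq_dalembertian, laplaceBeltrami_eq_dalembertian,
    g.dalembertian_real_comp hsm hζ, heik, mul_one]

/-- **Barrier-type bound `Δ(ζ ∘ r) ≤ ζ''(r) + ζ'(r)(m-1) coth r` for nondecreasing `ζ`** off
`{q} ∪ Cut(q)` under `Ric ≥ -(m-1)` (chain rule, eikonal equation, and the classical Laplacian
comparison `Δr ≤ (m-1) coth r` at smooth points). [cite: CheegerColding1996, §1]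
[cite: Chavel2006, Thm. III.4.3] -/
theorem laplaceBeltrami_real_comp_edist_le_coth [ConnectedSpace M] (hg : g.IsRiemannian)
    (hc : IsGeodesicallyComplete g.leviCivita)
    (hRic : ∀ (x : M) (w : TangentSpace 𝓘(ℝ, E) x),
      -((Module.finrank ℝ E : ℝ) - 1) * g.val x w w ≤ g.leviCivita.ricci x w w)
    {q z : M} (hz : z ∉ cutLocus g hg q) (hzq : z ≠ q)
    {ζ : ℝ → ℝ} (hζ : ContDiffAt ℝ 2 ζ (g.edist hg q z).toReal) (hζ' : 0 ≤ deriv ζ (g.edist hg q z).toReal) :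
    g.laplaceBeltrami (ζ ∘ fun z' ↦ (g.edist hg q z').toReal) z ≤
      deriv (deriv ζ) (g.edist hg q z).toReal +
        deriv ζ (g.edist hg q z).toReal * (((Module.finrank ℝ E : ℝ) - 1) *
          (Real.cosh (g.edist hg q z).toReal / Real.sinh (g.edist hg q z).toReal)) := by
  rw [laplaceBeltrami_real_comp_edist g hg hc hz hzq hζ]
  -- `z = exp_q w`, `w ∈ ID(q) ∖ {0}`
  obtain ⟨-, -, himg, -, -⟩ := lee_expMap_injectivityDomain_holds le_rfl g hg hc q
  have hz1 := hz
  rw [cutLocus_eq_geodesicCutLocus le_rfl hg hc q] at hz1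
  have hz' : z ∈ (geodesicCutLocus g hg q)ᶜ := hz1
  rw [← himg] at hz'
  obtain ⟨w, hw, rfl⟩ := hz'
  have hw0 : w ≠ 0 := by
    rintro rfl
    exact hzq (expMap_zero (cov := g.leviCivita) q)
  have hΔ := laplaceBeltrami_edist_le_coth_of_mem_injectivityDomain g hg hc hRic q hw hw0
  have hre : riemannianExpMap g q w = expMap g.leviCivita q w := rfl
  simp only [hre] at hζ' ⊢
  have := mul_le_mul_of_nonneg_left hΔ hζ'
  linarith

/-! ### (v) The gradient of the distance function is the radial unit vector -/

omit [CompleteSpace E] [T2Space M] [g.HasLeviCivita]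
  [CovariantDerivative.ContMDiffCovariantDerivative g.leviCivita 1]
  [CovariantDerivative.ContMDiffCovariantDerivative g.leviCivita ∞] in
/-- A covector `α` with `g⁻¹(α, α) = 1` taking the value `1` on a unit vector `V` has `♯α = V`
(expand `|♯α - V|² = 1 - 2 α(V) + 1 = 0`). [folklore] -/
theorem sharp_eq_of_innerDual_eq_one_of_apply_eq_one (hg : g.IsRiemannian) {x : M}
    {α : Module.Dual ℝ (TangentSpace 𝓘(ℝ, E) x)} {V : TangentSpace 𝓘(ℝ, E) x}
    (hα : g.innerDual x α α = 1) (hV : g.val x V V = 1) (hαV : α V = 1) : g.sharp x α = V := by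
  have h1 : g.val x (g.sharp x α - V) (g.sharp x α - V) = 0 := by
    have e1 : g.val x (g.sharp x α) (g.sharp x α) = 1 := by
      rw [← innerDual_eq_val_sharp_sharp]; exact hα
    have e2 : g.val x (g.sharp x α) V = 1 := by rw [val_sharp_apply]; exact hαV
    have e3 : g.val x V (g.sharp x α) = 1 := by rw [g.symm]; exact e2
    simp only [map_sub, FunLike.coe_sub, Pi.sub_apply, e1, e2, e3, hV]
    ring
  by_contra hne
  exact (hg x _ (sub_ne_zero.2 hne)).ne' h1

/-- **`∇ d(q, ·) = γ̇`** along a unit-speed geodesic `γ(σ) = exp_q(σ u)` minimizing on `[0, T]`,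
`T > 0`, at `γ(T)` where `d(q, ·)` is differentiable: the metric dual of `d(d(q,·))_{γ(T)}` is the
velocity `γ̇(T)` (radial derivative `1`, `|∇d|² = 1`, `|γ̇| = 1`). Lee 2018, Thm. 6.32 / Prop. 6.31
("`grad r = ∂_r`" on normal neighbourhoods), here globally off the cut locus.
[cite: LeeRiemannianManifolds2018, Thm. 6.34] -/
theorem sharp_mvfderiv_edist_eq_velocity [ConnectedSpace M] (hg : g.IsRiemannian)
    (hc : IsGeodesicallyComplete g.leviCivita) (q : M) (u : TangentSpace 𝓘(ℝ, E) q)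
    (hu : g.val q u u = 1) {T : ℝ} (hT : 0 < T) (hmin : IsMinimizingUpTo g hg q u T)
    (hf : MDifferentiableAt 𝓘(ℝ, E) 𝓘(ℝ, ℝ) (fun z ↦ (g.edist hg q z).toReal)
      (expMap g.leviCivita q (T • u))) :
    g.sharp (expMap g.leviCivita q (T • u))
        (mvfderiv 𝓘(ℝ, E) (fun z ↦ (g.edist hg q z).toReal) (expMap g.leviCivita q (T • u)) :
          TangentSpace 𝓘(ℝ, E) (expMap g.leviCivita q (T • u)) →ₗ[ℝ] ℝ) =
      velocity 𝓘(ℝ, E) (fun σ ↦ expMap g.leviCivita q (σ • u)) T := by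
  have hrad := mvfderiv_edist_velocity_eq_one g hg hc q u hu hT hmin hf
  have hspeed : g.val (expMap g.leviCivita q (T • u))
      (velocity 𝓘(ℝ, E) (fun σ ↦ expMap g.leviCivita q (σ • u)) T)
      (velocity 𝓘(ℝ, E) (fun σ ↦ expMap g.leviCivita q (σ • u)) T) = 1 := by
    rw [val_velocity_expMap_smul g hc q u T, hu]
  -- `|∇d|² = 1` at the point (it is differentiable there and `≠ q`)
  have hxq : expMap g.leviCivita q (T • u) ≠ q := by
    intro h
    have h1 := edist_expMap_smul_expMap_smul g hg hc q u hu hmin le_rfl hT.le le_rfl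
    rw [zero_smul, expMap_zero, h, PseudoRiemannianMetric.edist_self, sub_zero] at h1
    have : (0 : ℝ≥0∞) ≠ ENNReal.ofReal T := (ENNReal.ofReal_pos.2 hT).ne
    exact this h1
  have hgrad : g.gradSq (fun z ↦ (g.edist hg q z).toReal) (expMap g.leviCivita q (T • u)) = 1 := by
    refine le_antisymm (gradSq_edist_le_one g hg hc q hf) ?_
    have hCS := abs_mvfderiv_le_sqrt_gradSq_mul_sqrt g hg (fun z ↦ (g.edist hg q z).toReal)
      (expMap g.leviCivita q (T • u)) (velocity 𝓘(ℝ, E) (fun σ ↦ expMap g.leviCivita q (σ • u)) T)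
    rw [hrad, hspeed, Real.sqrt_one, mul_one, abs_one] at hCS
    have hnn : 0 ≤ g.gradSq (fun z ↦ (g.edist hg q z).toReal) (expMap g.leviCivita q (T • u)) := by
      by_contra hneg
      rw [not_le] at hneg
      rw [Real.sqrt_eq_zero'.2 hneg.le] at hCS
      linarith
    calc (1 : ℝ) = 1 ^ 2 := by norm_num
      _ ≤ Real.sqrt (g.gradSq (fun z ↦ (g.edist hg q z).toReal) (expMap g.leviCivita q (T • u))) ^ 2 := by
          gcongr
      _ = _ := Real.sq_sqrt hnn
  exact sharp_eq_of_innerDual_eq_one_of_apply_eq_one g hg hgrad hspeed hrad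

end Literature.Geometry.Riemannian

end
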